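import Summits.QuantumFields.BalabanUV.T4Continuum.Support.NE7LyapunovIdentification
import Summits.QuantumFields.BalabanUV.T4Continuum.Support.NE3CoarseInterpolant
import HarnessLib

/-!
# NE7LyapunovMainPartComposites — THE COMPOSITES OF THE EXACT LIFT'S MAIN PART `W∘B_c⁻¹` ARE BOUNDED WITH RATIO `7.2 < 8 = L³` (`d = 4`, `L = 2`):
# `‖·‖² ≤ Q ≤ 12⁴·‖·‖²` on periodic fields, `Q_{2^m N}((W∘B_c⁻¹)^{(m)} u) ≤ 7.2^m·Q_N(u)`, hence `Σ_{[0,2^mN)⁴}‖(W∘B_c⁻¹)^{(m)}u‖² ≤ 12⁴·7.2^m·Σ_{[0,N)⁴}‖u‖²` — (R3c), the main part of (C)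
# (lineage `b2b-balaban-t4-ne7b-p1`, gen 163; route (H′), memo `t4/b2b-balaban-t4-ne7b-p1/g162/records/SCOPING-LEVELMASSES.md` §12 (R3c))

Cell `pub-balaban`, rung (B)+1 sub-cell t4, lineage `b2b-balaban-t4-ne7b-p1` (row NE7b OWNER + CRUX PROVER; junction service for row NE7 on ROAD-G116 §6 (G3) ∕ the ℓ² route to (G′)),
generation 163.
WHY.  ✓ `NE7LyapunovIdentification.lyapQ_mainPart_step` is the one-level Lyapunov letter of the main part of the exact lift of record (✓ `NE7WhitneyExactLiftFlat`: `r = W∘B_c⁻¹ −`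
gauge part).  THIS FILE iterates it over the levels and converts the Lyapunov mass `Q` into the plain `ℓ²` mass: every stencil is bounded in `ℓ²` on periodic fields by its `ℓ¹` mass
(Young), so `Q ≤ (Σ_a c_a m_a²)⁴·‖·‖² = 12⁴·‖·‖²` (`m = (1, 2, 4)` the masses of `δ, ∇, Δ`), and `Q ≥ ‖·‖²` (its `α = 0` term).  Result: the composites of the main part over any
number of levels are bounded in `ℓ²` with ratio `7.2` per level — the numerics of memo §9–§10 (`C_ℓ = 46, 125, 202, 259` at ratios `↓`) inside a kernel theorem.
WHAT ([folklore]; DATA defs `stMass`, `mD`, `mainC`, `mainIter`; 0 sorry; `X` any real inner product space):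
§1 **`sum_norm_sq_act_le`** (Young on the period box: `Σ_x‖act s v x‖² ≤ (Σ_k|c_k|)²·Σ_x‖v x‖²` for periodic `v`), `stMass_Dst` (`= 1, 2, 4`);
§2 **`sum_norm_sq_le_lyapQ`** (`Σ_{[0,P)⁴}‖f‖² ≤ Q_P(f)`), **`lyapQ_le`** (`Q_P(f) ≤ 12⁴·Σ_{[0,P)⁴}‖f‖²` for `P`-periodic `f`), `lyapQ_nonneg`;
§3 `mainC N κ u := x ↦ ½ • interp 2 (univ∖{κ}) (stencilInv N ¼ u) x` (one component of `W∘B_c⁻¹` from period `N` to period `2N`), `mainC_periodic`, the iterate `mainIter N κ m`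
   (`m` levels, periods `N, 2N, …, 2^m N`), `mainIter_periodic`, **`lyapQ_mainIter_le`** (`≤ (3(17∕8)³∕4)^m · Q_N(u)`), and the headline
   **`sum_norm_sq_mainIter_le`**: `Σ_{x∈[0,2^mN)⁴} ‖mainIter N κ m u x‖² ≤ 12⁴·(3(17∕8)³∕4)^m·Σ_{x∈[0,N)⁴}‖u x‖²` for `N ≥ 1` and `N`-periodic `u`.
WHAT IS NOT HERE: the gauge part of `r` (exact reproduction of gauge directions, W's sharp bound), the matrix∕operator-norm currency, (C) in root form — next files.
HONEST FRAMING (page 1): elementary lattice analysis about OUR lift; nothing of Bałaban's asserted; NOT (C), NOT (G3), NOT (G′), NOT NE7∕NE3 as spine nodes; row NE7b NOT PRINTED ∕ NOT PROVED;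
spine 0∕9; finite T⁴ rung (B)+1 — NOT infinite volume, NOT mass gap, NOT BetaPertH, NOT Clay.
-/

set_option autoImplicit false

open scoped BigOperators RealInnerProductSpace
open Finset

namespace Summit.QuantumFields.BalabanUV.T4Continuum.NE7LyapunovMainPartComposites

open Literature.MathematicalPhysics.QuantumFieldTheory.Balaban1983to89
open B7Prop1Explicit
open T4AveragingDeficitWallBoundary (periodBox mem_periodBox sum_periodBox_shift)
open SmoothRefineInterp (interp)
open NE3CoarseInterpolant (interp_add_period)
open NE7StencilForms (act conv formProd act_conv)
open NE7LyapunovTensor (delta4 grad4 act_delta4 act_grad4)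
open NE7LyapunovTorusBridge (formEvalP act_periodic)
open NE7LyapunovCellTable (lap4 Dst act_lap4)
open NE7LyapunovIdentification (cM cM_nonneg Mform lyapQ formEvalP_prod4 lyapQ_mainPart_step)
open NE7StencilInverse (stencilInv stencilInv_periodic)

noncomputable section

variable {d : ℕ}
variable {X : Type*} [NormedAddCommGroup X] [InnerProductSpace ℝ X]

/-! ## §1 Young's inequality for stencils on the period box; the masses of `δ, ∇, Δ` -/

/-- The `ℓ¹` mass of a stencil: `Σ_k |c_k|`. [folklore] -/
def stMass {Γ : Type*} {κ : Type*} [Fintype κ] (s : κ → ℝ × Γ) : ℝ := ∑ k, |(s k).1|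

omit [InnerProductSpace ℝ X] in
/-- Pointwise: `‖act s v y‖ ≤ Σ_k |c_k|·‖v (y + a_k)‖`. [folklore] -/
theorem norm_act_le {Γ : Type*} [AddCommGroup Γ] {κ : Type*} [Fintype κ] [InnerProductSpace ℝ X] (s : κ → ℝ × Γ) (v : Γ → X) (y : Γ) :
    ‖act s v y‖ ≤ ∑ k, |(s k).1| * ‖v (y + (s k).2)‖ := by
  unfold act
  refine (norm_sum_le _ _).trans (Finset.sum_le_sum fun k _ => ?_)
  rw [norm_smul, Real.norm_eq_abs]

/-- **YOUNG'S INEQUALITY ON THE PERIOD BOX**: for a `P`-periodic field `v` (`P ≥ 1`), `Σ_{x∈[0,P)^d} ‖act s v x‖² ≤ (Σ_k |c_k|)² · Σ_{x∈[0,P)^d} ‖v x‖²`. [folklore] -/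
theorem sum_norm_sq_act_le {κ : Type*} [Fintype κ] {P : ℕ} (hP : 1 ≤ P) (s : κ → ℝ × Site d) {v : Site d → X}
    (hv : ∀ (y : Site d) (j : Fin d), v (y + (P : ℤ) • e j) = v y) :
    ∑ x ∈ periodBox (d := d) P, ‖act s v x‖ ^ 2 ≤ stMass s ^ 2 * ∑ x ∈ periodBox (d := d) P, ‖v x‖ ^ 2 := by
  -- pointwise weighted Cauchy–Schwarz: `‖act s v x‖² ≤ (Σ|c|)·Σ_k |c_k| ‖v(x+a_k)‖²`
  have hpt : ∀ x : Site d, ‖act s v x‖ ^ 2 ≤ stMass s * ∑ k, |(s k).1| * ‖v (x + (s k).2)‖ ^ 2 := by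
    intro x
    have h1 := norm_act_le s v x
    have h2 : (∑ k, |(s k).1| * ‖v (x + (s k).2)‖) ^ 2 ≤ (∑ k, |(s k).1|) * ∑ k, |(s k).1| * ‖v (x + (s k).2)‖ ^ 2 :=
      sum_sq_le_sum_mul_sum_of_sq_le_mul _ (fun k _ => abs_nonneg _) (fun k _ => by positivity) (fun k _ => by rw [mul_pow]; ring_nf; rfl)
    exact (pow_le_pow_left₀ (norm_nonneg _) h1 2).trans h2
  -- sum over the box and use shift invariance
  have hshift : ∀ k, ∑ x ∈ periodBox (d := d) P, ‖v (x + (s k).2)‖ ^ 2 = ∑ x ∈ periodBox (d := d) P, ‖v x‖ ^ 2 :=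
    fun k => sum_periodBox_shift P hP (g := fun x => ‖v x‖ ^ 2) (fun x j => by simp only [hv]) (s k).2
  calc ∑ x ∈ periodBox (d := d) P, ‖act s v x‖ ^ 2
      ≤ ∑ x ∈ periodBox (d := d) P, stMass s * ∑ k, |(s k).1| * ‖v (x + (s k).2)‖ ^ 2 := Finset.sum_le_sum fun x _ => hpt x
    _ = stMass s * ∑ k, |(s k).1| * ∑ x ∈ periodBox (d := d) P, ‖v (x + (s k).2)‖ ^ 2 := by
        rw [← Finset.mul_sum, Finset.sum_comm]
        simp only [Finset.mul_sum]
    _ = stMass s ^ 2 * ∑ x ∈ periodBox (d := d) P, ‖v x‖ ^ 2 := by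
        simp only [hshift]
        rw [← Finset.sum_mul, sq, mul_assoc]
        rfl

/-- The masses of the difference stencils: `m = (1, 2, 4)`. [folklore] -/
def mD : Fin 3 → ℝ := ![1, 2, 4]

/-- `stMass (Dst a j) = mD j`. [folklore] -/
theorem stMass_Dst {Γ : Type*} [AddCommGroup Γ] (a : Γ) (j : Fin 3) : stMass (Dst a j) = mD j := by
  fin_cases j <;> simp [stMass, Dst, mD, delta4, grad4, lap4, Fin.sum_univ_four] <;> norm_num

/-- `Σ_a c_a · m_a² = 1·1 + ¼·4 + ⅝·16 = 12`. [folklore] -/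
theorem sum_cM_mul_mD_sq : ∑ a : Fin 3, cM a * mD a ^ 2 = 12 := by
  simp [Fin.sum_univ_three, cM, mD]; norm_num

/-! ## §2 `‖·‖² ≤ Q ≤ 12⁴‖·‖²` -/

/-- **THE LYAPUNOV MASS DOMINATES THE PLAIN MASS**: `Σ_{x∈[0,P)⁴} ‖f x‖² ≤ lyapQ P f` (the `α = 0` term; all terms are nonnegative). [folklore] -/
theorem sum_norm_sq_le_lyapQ (P : ℕ) (f : Site 4 → X) : ∑ x ∈ periodBox (d := 4) P, ‖f x‖ ^ 2 ≤ lyapQ P f := by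
  unfold lyapQ formEvalP
  have h0 : (formProd (formProd (formProd (Mform (e (0 : Fin 4))) (Mform (e (1 : Fin 4)))) (Mform (e (2 : Fin 4)))) (Mform (e (3 : Fin 4))) (((0, 0), 0), 0)).1
      * ∑ x ∈ periodBox (d := 4) P, ‖act (formProd (formProd (formProd (Mform (e (0 : Fin 4))) (Mform (e (1 : Fin 4)))) (Mform (e (2 : Fin 4)))) (Mform (e (3 : Fin 4))) (((0, 0), 0), 0)).2 f x‖ ^ 2
      = ∑ x ∈ periodBox (d := 4) P, ‖f x‖ ^ 2 := by
    have hδ : act (formProd (formProd (formProd (Mform (e (0 : Fin 4))) (Mform (e (1 : Fin 4)))) (Mform (e (2 : Fin 4)))) (Mform (e (3 : Fin 4))) (((0, 0), 0), 0)).2 f = f := by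
      funext x
      simp only [formProd, Mform, Dst, Matrix.cons_val_zero, act_conv, act_delta4]
    rw [hδ]
    simp [formProd, Mform, cM]
  rw [← h0]
  refine Finset.single_le_sum (f := fun i => (formProd (formProd (formProd (Mform (e (0 : Fin 4))) (Mform (e (1 : Fin 4)))) (Mform (e (2 : Fin 4)))) (Mform (e (3 : Fin 4))) i).1
      * ∑ x ∈ periodBox (d := 4) P, ‖act (formProd (formProd (formProd (Mform (e (0 : Fin 4))) (Mform (e (1 : Fin 4)))) (Mform (e (2 : Fin 4)))) (Mform (e (3 : Fin 4))) i).2 f x‖ ^ 2)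
    (fun i _ => mul_nonneg ?_ (Finset.sum_nonneg fun _ _ => sq_nonneg _)) (Finset.mem_univ _)
  simp only [formProd, Mform]
  exact mul_nonneg (mul_nonneg (mul_nonneg (cM_nonneg _) (cM_nonneg _)) (cM_nonneg _)) (cM_nonneg _)

/-- The Lyapunov mass is nonnegative. [folklore] -/
theorem lyapQ_nonneg (P : ℕ) (f : Site 4 → X) : 0 ≤ lyapQ P f :=
  (Finset.sum_nonneg fun _ _ => sq_nonneg _).trans (sum_norm_sq_le_lyapQ P f)

/-- **THE LYAPUNOV MASS IS AT MOST `12⁴` TIMES THE PLAIN MASS** on `P`-periodic fields (`P ≥ 1`): `lyapQ P f ≤ 12⁴ · Σ_{x∈[0,P)⁴} ‖f x‖²` (Young, direction by direction). [folklore] -/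
theorem lyapQ_le {P : ℕ} (hP : 1 ≤ P) {f : Site 4 → X} (hf : ∀ (y : Site 4) (j : Fin 4), f (y + (P : ℤ) • e j) = f y) :
    lyapQ P f ≤ (12 : ℝ) ^ 4 * ∑ x ∈ periodBox (d := 4) P, ‖f x‖ ^ 2 := by
  set E : ℝ := ∑ x ∈ periodBox (d := 4) P, ‖f x‖ ^ 2 with hE
  have hE0 : 0 ≤ E := Finset.sum_nonneg fun _ _ => sq_nonneg _
  -- the nested Young bound for one multi-index
  have hterm : ∀ i₀ i₁ i₂ i₃ : Fin 3,
      ∑ x ∈ periodBox (d := 4) P, ‖act (Dst (e (0 : Fin 4)) i₀) (act (Dst (e (1 : Fin 4)) i₁) (act (Dst (e (2 : Fin 4)) i₂) (act (Dst (e (3 : Fin 4)) i₃) f))) x‖ ^ 2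
        ≤ mD i₀ ^ 2 * (mD i₁ ^ 2 * (mD i₂ ^ 2 * (mD i₃ ^ 2 * E))) := by
    intro i₀ i₁ i₂ i₃
    have p3 : ∀ (y : Site 4) (j : Fin 4), act (Dst (e (3 : Fin 4)) i₃) f (y + (P : ℤ) • e j) = act (Dst (e (3 : Fin 4)) i₃) f y := act_periodic _ hf
    have p2 : ∀ (y : Site 4) (j : Fin 4), act (Dst (e (2 : Fin 4)) i₂) (act (Dst (e (3 : Fin 4)) i₃) f) (y + (P : ℤ) • e j) = act (Dst (e (2 : Fin 4)) i₂) (act (Dst (e (3 : Fin 4)) i₃) f) y :=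
      act_periodic _ p3
    have p1 : ∀ (y : Site 4) (j : Fin 4), act (Dst (e (1 : Fin 4)) i₁) (act (Dst (e (2 : Fin 4)) i₂) (act (Dst (e (3 : Fin 4)) i₃) f)) (y + (P : ℤ) • e j)
        = act (Dst (e (1 : Fin 4)) i₁) (act (Dst (e (2 : Fin 4)) i₂) (act (Dst (e (3 : Fin 4)) i₃) f)) y := act_periodic _ p2
    have h0 := sum_norm_sq_act_le hP (Dst (e (0 : Fin 4)) i₀) p1
    have h1 := sum_norm_sq_act_le hP (Dst (e (1 : Fin 4)) i₁) p2
    have h2 := sum_norm_sq_act_le hP (Dst (e (2 : Fin 4)) i₂) p3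
    have h3 := sum_norm_sq_act_le hP (Dst (e (3 : Fin 4)) i₃) hf
    rw [stMass_Dst] at h0 h1 h2 h3
    have m0 := sq_nonneg (mD i₀); have m1 := sq_nonneg (mD i₁); have m2 := sq_nonneg (mD i₂)
    calc _ ≤ mD i₀ ^ 2 * _ := h0
      _ ≤ mD i₀ ^ 2 * (mD i₁ ^ 2 * _) := mul_le_mul_of_nonneg_left h1 m0
      _ ≤ mD i₀ ^ 2 * (mD i₁ ^ 2 * (mD i₂ ^ 2 * _)) := mul_le_mul_of_nonneg_left (mul_le_mul_of_nonneg_left h2 m1) m0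
      _ ≤ mD i₀ ^ 2 * (mD i₁ ^ 2 * (mD i₂ ^ 2 * (mD i₃ ^ 2 * E))) :=
          mul_le_mul_of_nonneg_left (mul_le_mul_of_nonneg_left (mul_le_mul_of_nonneg_left h3 m2) m1) m0
  unfold lyapQ
  rw [formEvalP_prod4]
  simp only [Mform]
  calc ∑ i₀, ∑ i₁, ∑ i₂, ∑ i₃, cM i₀ * cM i₁ * cM i₂ * cM i₃
          * ∑ x ∈ periodBox (d := 4) P, ‖act (Dst (e (0 : Fin 4)) i₀) (act (Dst (e (1 : Fin 4)) i₁) (act (Dst (e (2 : Fin 4)) i₂) (act (Dst (e (3 : Fin 4)) i₃) f))) x‖ ^ 2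
      ≤ ∑ i₀, ∑ i₁, ∑ i₂, ∑ i₃, cM i₀ * cM i₁ * cM i₂ * cM i₃ * (mD i₀ ^ 2 * (mD i₁ ^ 2 * (mD i₂ ^ 2 * (mD i₃ ^ 2 * E)))) := by
        refine Finset.sum_le_sum fun i₀ _ => Finset.sum_le_sum fun i₁ _ => Finset.sum_le_sum fun i₂ _ => Finset.sum_le_sum fun i₃ _ => ?_
        exact mul_le_mul_of_nonneg_left (hterm i₀ i₁ i₂ i₃) (mul_nonneg (mul_nonneg (mul_nonneg (cM_nonneg _) (cM_nonneg _)) (cM_nonneg _)) (cM_nonneg _))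
    _ = ∑ i₀, cM i₀ * mD i₀ ^ 2 * ∑ i₁, cM i₁ * mD i₁ ^ 2 * ∑ i₂, cM i₂ * mD i₂ ^ 2 * ∑ i₃, cM i₃ * mD i₃ ^ 2 * E := by
        simp only [Finset.mul_sum]
        refine Finset.sum_congr rfl fun i₀ _ => Finset.sum_congr rfl fun i₁ _ => Finset.sum_congr rfl fun i₂ _ => Finset.sum_congr rfl fun i₃ _ => ?_
        ring
    _ = (12 : ℝ) ^ 4 * E := by
        rw [← Finset.sum_mul, sum_cM_mul_mD_sq, ← Finset.sum_mul, sum_cM_mul_mD_sq, ← Finset.sum_mul, sum_cM_mul_mD_sq, ← Finset.sum_mul, sum_cM_mul_mD_sq]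
        ring

/-! ## §3 The main part, one component, iterated over the levels -/

/-- **ONE COMPONENT OF THE MAIN PART `W∘B_c⁻¹` OF THE EXACT LIFT** (`M = L = 2`, `c = ¼`), from period `N` to period `2N`: `x ↦ ½ • interp 2 (univ∖{κ}) (stencilInv N ¼ u) x`. [folklore] -/
def mainC (N : ℕ) (κ : Fin 4) (u : Site 4 → X) : Site 4 → X := fun x => (2 : ℝ)⁻¹ • interp 2 (Finset.univ.erase κ) (stencilInv N (1 / 4 : ℝ) u) x

/-- The main part of an `N`-periodic component is `2N`-periodic. [folklore] -/
theorem mainC_periodic (N : ℕ) (κ : Fin 4) {u : Site 4 → X} (hu : ∀ (y : Site 4) (j : Fin 4), u (y + (N : ℤ) • e j) = u y) (y : Site 4) (j : Fin 4) :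
    mainC N κ u (y + ((2 * N : ℕ) : ℤ) • e j) = mainC N κ u y := by
  unfold mainC
  have hφ : ∀ (z : Site 4) (τ : Fin 4), stencilInv N (1 / 4 : ℝ) u (z + (N : ℤ) • e τ) = stencilInv N (1 / 4 : ℝ) u z :=
    fun z τ => stencilInv_periodic N _ (fun x => hu x τ) z
  rw [interp_add_period (by norm_num : 1 ≤ 2) (Finset.univ.erase κ) hφ y j]

/-- **THE ITERATED MAIN PART** over `m` levels, starting at period `N`: `mainIter N κ 0 = id`, `mainIter N κ (m+1) = mainC (2^m N) κ ∘ mainIter N κ m`. [folklore] -/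
def mainIter (N : ℕ) (κ : Fin 4) : ℕ → (Site 4 → X) → (Site 4 → X)
  | 0, u => u
  | m + 1, u => mainC (2 ^ m * N) κ (mainIter N κ m u)

/-- The iterate of an `N`-periodic component over `m` levels is `2^m N`-periodic. [folklore] -/
theorem mainIter_periodic (N : ℕ) (κ : Fin 4) {u : Site 4 → X} (hu : ∀ (y : Site 4) (j : Fin 4), u (y + (N : ℤ) • e j) = u y) :
    ∀ (m : ℕ) (y : Site 4) (j : Fin 4), mainIter N κ m u (y + ((2 ^ m * N : ℕ) : ℤ) • e j) = mainIter N κ m u y := by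
  intro m
  induction m with
  | zero => intro y j; simpa [mainIter] using hu y j
  | succ m ih =>
      intro y j
      have h := mainC_periodic (2 ^ m * N) κ ih y j
      rw [show 2 * (2 ^ m * N) = 2 ^ (m + 1) * N by ring] at h
      exact h

/-- **THE LYAPUNOV MASS OF THE ITERATED MAIN PART** (`N ≥ 1`, `u` `N`-periodic): `lyapQ (2^m N) (mainIter N κ m u) ≤ (3(17∕8)³∕4)^m · lyapQ N u`. [folklore] -/
theorem lyapQ_mainIter_le {N : ℕ} (hN : 1 ≤ N) (κ : Fin 4) {u : Site 4 → X} (hu : ∀ (y : Site 4) (j : Fin 4), u (y + (N : ℤ) • e j) = u y) :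
    ∀ m : ℕ, lyapQ (2 ^ m * N) (mainIter N κ m u) ≤ (3 * (17 / 8 : ℝ) ^ 3 / 4) ^ m * lyapQ N u := by
  intro m
  induction m with
  | zero => simp [mainIter]
  | succ m ih =>
      have hP : 1 ≤ 2 ^ m * N := Nat.mul_pos (Nat.two_pow_pos m) hN
      have hstep := lyapQ_mainPart_step (X := X) hP κ (mainIter_periodic N κ hu m)
      rw [show 2 * (2 ^ m * N) = 2 ^ (m + 1) * N by ring] at hstep
      calc lyapQ (2 ^ (m + 1) * N) (mainIter N κ (m + 1) u) ≤ (3 * (17 / 8 : ℝ) ^ 3 / 4) * lyapQ (2 ^ m * N) (mainIter N κ m u) := hstep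
        _ ≤ (3 * (17 / 8 : ℝ) ^ 3 / 4) * ((3 * (17 / 8 : ℝ) ^ 3 / 4) ^ m * lyapQ N u) := mul_le_mul_of_nonneg_left ih (by norm_num)
        _ = (3 * (17 / 8 : ℝ) ^ 3 / 4) ^ (m + 1) * lyapQ N u := by ring

/-- **HEADLINE — THE COMPOSITES OF THE MAIN PART ARE BOUNDED WITH RATIO `7.2 < 8 = L³`** (`d = 4`, `L = 2`, `N ≥ 1`, `u` an `N`-periodic component):
`Σ_{x∈[0,2^mN)⁴} ‖mainIter N κ m u x‖² ≤ 12⁴ · (3(17∕8)³∕4)^m · Σ_{x∈[0,N)⁴} ‖u x‖²` — uniformly in `m`, `N`, `κ`. [folklore] -/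
theorem sum_norm_sq_mainIter_le {N : ℕ} (hN : 1 ≤ N) (κ : Fin 4) {u : Site 4 → X} (hu : ∀ (y : Site 4) (j : Fin 4), u (y + (N : ℤ) • e j) = u y) (m : ℕ) :
    ∑ x ∈ periodBox (d := 4) (2 ^ m * N), ‖mainIter N κ m u x‖ ^ 2 ≤ (12 : ℝ) ^ 4 * (3 * (17 / 8 : ℝ) ^ 3 / 4) ^ m * ∑ x ∈ periodBox (d := 4) N, ‖u x‖ ^ 2 := by
  have h1 := sum_norm_sq_le_lyapQ (2 ^ m * N) (mainIter N κ m u)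
  have h2 := lyapQ_mainIter_le hN κ hu m
  have h3 := lyapQ_le hN hu
  calc ∑ x ∈ periodBox (d := 4) (2 ^ m * N), ‖mainIter N κ m u x‖ ^ 2 ≤ (3 * (17 / 8 : ℝ) ^ 3 / 4) ^ m * lyapQ N u := h1.trans h2
    _ ≤ (3 * (17 / 8 : ℝ) ^ 3 / 4) ^ m * ((12 : ℝ) ^ 4 * ∑ x ∈ periodBox (d := 4) N, ‖u x‖ ^ 2) := mul_le_mul_of_nonneg_left h3 (by positivity)
    _ = (12 : ℝ) ^ 4 * (3 * (17 / 8 : ℝ) ^ 3 / 4) ^ m * ∑ x ∈ periodBox (d := 4) N, ‖u x‖ ^ 2 := by ring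

end

end Summit.QuantumFields.BalabanUV.T4Continuum.NE7LyapunovMainPartComposites
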